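import Summits.CriticalPhenomena.PercolationContinuityZ3.Theorems.PercNearOneGluingNoHeavyLowerTailKNQuestion9ContractLaw
import Literature.Probability.Percolation.KozmaNitzanHittable
import HarnessLib

/-!
# Kozma–Nitzan's Question 9: from weights `< 1` off the observer to ALL weights (contraction of the weight-one pairs)

Support file (`--supports stmt-CriticalPhenomena-4575`), prover `prim-ineq-gen-7` (gen 9).  No definitions, no named facts, no sorries.
Memo `prim-ineq-gen-7/PROOF-Q9-MIXED-CSH.md` §8; closes the gap between `MixCSH.kn_question9` (weights `< 1` off `o`) and the all-weights socket
`setSourceExchange_of_question9` / `shorteningStep_of_question9` (prim-lf-2).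

`KnQ9Contract.question9_allWeights`: on a fixed finite vertex type, IF Question 9 (with the `H`-designation, `H = restrW {o}ᶜ w`) holds for every weight
function `< 1` on the pairs off the observer, THEN it holds for every weight function.  Induction on the number of weight-`1` pairs off `o`: such a pair
`e₀ = s(u,u')` is contracted (`KnQ9Contract.contract / cweight`, law `map_contract`, connections `reachable_contract_iff`); the relay graph of the
contraction is the contraction of the relay graph (`cweight_restrW`), the designation and both sides of (41) are transported exactly
(`real_eq_of_contract`), and the contraction has fewer weight-`1` pairs off `o` (`card_ones_cweight_lt`).
[cite: KozmaNitzan2024, Question 9 (§5.5 p. 36), §5.6 (1)]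
-/

noncomputable section

namespace Summit.CriticalPhenomena.PercolationContinuityZ3.Theorems

open MeasureTheory Set unitInterval Literature.Probability.LatticeModels Literature.Probability.Percolation
open scoped Classical

namespace KnQ9Contract

variable {V : Type*}

/-- `π` fixes every vertex other than `u'`. [folklore] -/
theorem proj_of_ne {u u' z : V} (h : z ≠ u') : proj u u' z = z := if_neg h

/-- `π u' = u`. [folklore] -/
theorem proj_self (u u' : V) : proj u u' u' = u := if_pos rfl

/-- **The relay graph of the contraction is the contraction of the relay graph** (`u, u' ≠ o`). [folklore] -/
theorem cweight_restrW {u u' o : V} (hu : u ≠ o) (hu' : u' ≠ o) (w : Sym2 V → unitInterval) :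
    cweight u u' (restrW ({o}ᶜ : Set V) w) = restrW ({o}ᶜ : Set V) (cweight u u' w) := by
  funext e
  induction e using Sym2.ind with
  | h a b =>
    by_cases hmem : s(a, b) ∈ wireSet ({o}ᶜ : Set V)
    · rw [restrW_apply_of_mem _ hmem]
      obtain ⟨hao, hbo, hab⟩ := mk_mem_wireSet_iff.1 hmem
      simp only [mem_compl_iff, mem_singleton_iff] at hao hbo
      rw [cweight_mk, cweight_mk]
      unfold cwFun
      by_cases h1 : a = u' ∨ b = u'
      · rw [if_pos h1, if_pos h1]
      · rw [if_neg h1, if_neg h1]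
        have hb' : restrW ({o}ᶜ : Set V) w s(b, u') = w s(b, u') := restrW_apply_of_mem w
          (mk_mem_wireSet_iff.2 ⟨hbo, hu', fun h => h1 (Or.inr h)⟩)
        have ha' : restrW ({o}ᶜ : Set V) w s(a, u') = w s(a, u') := restrW_apply_of_mem w
          (mk_mem_wireSet_iff.2 ⟨hao, hu', fun h => h1 (Or.inl h)⟩)
        rw [restrW_apply_of_mem w hmem, hb', ha']
    · rw [restrW_apply_of_not_mem _ hmem, cweight_mk]
      unfold cwFun
      by_cases h1 : a = u' ∨ b = u'
      · rw [if_pos h1]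
      · rw [if_neg h1]
        -- `s(a,b) ∉ wireSet {o}ᶜ`: `a = o`, `b = o` or `a = b`
        have hcase : a = o ∨ b = o ∨ a = b := by
          by_contra hc
          push Not at hc
          exact hmem (mk_mem_wireSet_iff.2 ⟨by simpa using hc.1, by simpa using hc.2.1, hc.2.2⟩)
        have hzero : ∀ z : V, restrW ({o}ᶜ : Set V) w s(o, z) = 0 := fun z =>
          restrW_apply_of_not_mem w fun h => by
            have := (mk_mem_wireSet_iff.1 h).1
            simp at this
        have hzero' : ∀ z : V, restrW ({o}ᶜ : Set V) w s(z, o) = 0 := fun z => by rw [Sym2.eq_swap]; exact hzero z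
        by_cases h2 : a = u ∧ b ≠ u
        · rw [if_pos h2]
          obtain ⟨rfl, hbu⟩ := h2
          have hbo : b = o := by
            rcases hcase with h | h | h
            · exact absurd h hu
            · exact h
            · exact absurd h.symm hbu
          subst hbo
          rw [hzero', hzero]; ext; simp
        · rw [if_neg h2]
          by_cases h3 : b = u ∧ a ≠ u
          · rw [if_pos h3]
            obtain ⟨rfl, hau⟩ := h3
            have hao : a = o := by
              rcases hcase with h | h | h
              · exact h
              · exact absurd h hu
              · exact absurd h hau
            subst hao
            rw [hzero, hzero]; ext; simp
          · rw [if_neg h3, restrW_apply_of_not_mem w hmem]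

variable [Fintype V]

/-- **Transport of `{x ↔ y} ∩ {o ↔ A}` under the contraction of a weight-one pair off `o`.** [cite: KozmaNitzan2024, §5.6 (1)] -/
theorem real_conn_inter_eq {u u' : V} (huu' : u ≠ u') (w : Sym2 V → unitInterval) (he₀ : w s(u, u') = 1) {o : V} (ho : o ≠ u')
    (x y : V) (A : Finset V) :
    (prodBernoulli w).real (openConn x y ∩ ⋃ a ∈ A, openConn o a) =
      (prodBernoulli (cweight u u' w)).real
        (openConn (proj u u' x) (proj u u' y) ∩ ⋃ a ∈ A.image (proj u u'), openConn o a) := by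
  refine real_eq_of_contract huu' w he₀ _ _ fun ω hω => ?_
  simp only [mem_inter_iff, mem_iUnion, exists_prop, Finset.mem_image]
  rw [show (ω ∈ openConn x y) = (openGraph ω).Reachable x y from rfl, reachable_contract_iff huu' hω]
  refine and_congr Iff.rfl ⟨?_, ?_⟩
  · rintro ⟨a, ha, h⟩
    refine ⟨proj u u' a, ⟨a, ha, rfl⟩, ?_⟩
    have h' := (reachable_contract_iff huu' hω o a).1 h
    rwa [proj_of_ne ho] at h'
  · rintro ⟨a', ⟨a, ha, rfl⟩, h⟩
    refine ⟨a, ha, (reachable_contract_iff huu' hω o a).2 ?_⟩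
    rwa [proj_of_ne ho]

/-- Transport of a connection probability. [cite: KozmaNitzan2024, §5.6 (1)] -/
theorem real_openConn_eq {u u' : V} (huu' : u ≠ u') (w : Sym2 V → unitInterval) (he₀ : w s(u, u') = 1) (x y : V) :
    (prodBernoulli w).real (openConn x y) = (prodBernoulli (cweight u u' w)).real (openConn (proj u u' x) (proj u u' y)) :=
  real_eq_of_contract huu' w he₀ _ _ fun _ hω => reachable_contract_iff huu' hω x y

/-- The weight-`1` pairs off the observer. [folklore] -/
theorem mem_ones_iff (w : Sym2 V → unitInterval) (o : V) (e : Sym2 V) :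
    e ∈ (Finset.univ.filter fun e => e ∈ wireSet ({o}ᶜ : Set V) ∧ w e = 1) ↔ e ∈ wireSet ({o}ᶜ : Set V) ∧ w e = 1 := by
  simp

/-- **The contraction has fewer weight-one pairs off `o`**: every weight-`1` pair of `cweight` off `o` is the image under `Sym2.map π` of a weight-`1`
pair of `w` off `o` other than `e₀`. [folklore] -/
theorem card_ones_cweight_lt {u u' o : V} (huu' : u ≠ u') (hu : u ≠ o) (hu' : u' ≠ o) (w : Sym2 V → unitInterval) (he₀ : w s(u, u') = 1) :
    (Finset.univ.filter fun e => e ∈ wireSet ({o}ᶜ : Set V) ∧ cweight u u' w e = 1).card <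
      (Finset.univ.filter fun e => e ∈ wireSet ({o}ᶜ : Set V) ∧ w e = 1).card := by
  set P := Finset.univ.filter fun e => e ∈ wireSet ({o}ᶜ : Set V) ∧ w e = 1 with hP
  have he₀P : s(u, u') ∈ P := by
    rw [hP, mem_ones_iff, mk_mem_wireSet_iff]
    exact ⟨⟨by simpa using hu, by simpa using hu', huu'⟩, he₀⟩
  have hsub : (Finset.univ.filter fun e => e ∈ wireSet ({o}ᶜ : Set V) ∧ cweight u u' w e = 1) ⊆
      (P.erase s(u, u')).image (Sym2.map (proj u u')) := by
    intro e he
    rw [Finset.mem_filter] at he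
    obtain ⟨-, hew, hce⟩ := he
    rw [Finset.mem_image]
    have hu'e : u' ∉ e := fun h => by
      rw [cweight_of_mem w h] at hce
      exact zero_ne_one hce
    induction e using Sym2.ind with
    | h a b =>
      obtain ⟨hao, hbo, hab⟩ := mk_mem_wireSet_iff.1 hew
      simp only [mem_compl_iff, mem_singleton_iff] at hao hbo
      have ha : a ≠ u' := fun h => hu'e (h ▸ Sym2.mem_mk_left a b)
      have hb : b ≠ u' := fun h => hu'e (h ▸ Sym2.mem_mk_right a b)
      -- the parallel case: one of the two pairs has weight one
      have hpar : ∀ z, z ≠ u → z ≠ u' → z ≠ o → cweight u u' w s(z, u) = 1 →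
          ∃ e' ∈ P.erase s(u, u'), Sym2.map (proj u u') e' = s(z, u) := by
        intro z hzu hzu' hzo hz1
        have hc := coe_cweight_parallel huu' w hzu hzu'
        rw [hz1] at hc
        have h0 : (1 - (w s(z, u) : ℝ)) * (1 - w s(z, u')) = 0 := by
          have : ((1 : unitInterval) : ℝ) = 1 := rfl
          linarith [hc]
        rcases mul_eq_zero.1 h0 with h | h
        · refine ⟨s(z, u), Finset.mem_erase.2 ⟨?_, ?_⟩, ?_⟩
          · intro heq
            rcases Sym2.eq_iff.1 heq with ⟨h1, _⟩ | ⟨h1, _⟩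
            · exact hzu h1
            · exact hzu' h1
          · rw [hP, mem_ones_iff, mk_mem_wireSet_iff]
            refine ⟨⟨by simpa using hzo, by simpa using hu, hzu⟩, ?_⟩
            exact Subtype.ext (by linarith)
          · rw [Sym2.map_mk, proj_of_ne hzu', proj_of_ne huu']
        · refine ⟨s(z, u'), Finset.mem_erase.2 ⟨?_, ?_⟩, ?_⟩
          · intro heq
            rcases Sym2.eq_iff.1 heq with ⟨h1, _⟩ | ⟨h1, _⟩
            · exact hzu h1
            · exact hzu' h1
          · rw [hP, mem_ones_iff, mk_mem_wireSet_iff]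
            refine ⟨⟨by simpa using hzo, by simpa using hu', hzu'⟩, ?_⟩
            exact Subtype.ext (by linarith)
          · rw [Sym2.map_mk, proj_of_ne hzu', proj_self]
      by_cases h1 : a = u ∧ b ≠ u
      · obtain ⟨rfl, hbu⟩ := h1
        obtain ⟨e', he', hmap⟩ := hpar b hbu hb hbo (by rw [Sym2.eq_swap]; exact hce)
        exact ⟨e', he', by rw [hmap, Sym2.eq_swap]⟩
      · by_cases h2 : b = u ∧ a ≠ u
        · obtain ⟨rfl, hau⟩ := h2
          exact hpar a hau ha hao hce
        · -- a pair avoiding `u'` not of parallel type keeps its weight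
          rw [cweight_of_not w ha hb h1 h2] at hce
          refine ⟨s(a, b), Finset.mem_erase.2 ⟨?_, ?_⟩, ?_⟩
          · intro heq
            rcases Sym2.eq_iff.1 heq with ⟨_, h⟩ | ⟨h, _⟩
            · exact hb h
            · exact ha h
          · rw [hP, mem_ones_iff]; exact ⟨hew, hce⟩
          · rw [Sym2.map_mk, proj_of_ne ha, proj_of_ne hb]
  calc (Finset.univ.filter fun e => e ∈ wireSet ({o}ᶜ : Set V) ∧ cweight u u' w e = 1).card
      ≤ ((P.erase s(u, u')).image (Sym2.map (proj u u'))).card := Finset.card_le_card hsub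
    _ ≤ (P.erase s(u, u')).card := Finset.card_image_le
    _ < P.card := Finset.card_erase_lt_of_mem he₀P

/-- **KOZMA–NITZAN'S QUESTION 9 AT ALL WEIGHTS FROM QUESTION 9 AT WEIGHTS `< 1` OFF THE OBSERVER** (fixed finite vertex type; induction on the number of
weight-one pairs off the observer, contracting one at a time). [cite: KozmaNitzan2024, Question 9 (§5.5 p. 36), §5.6 (1)] -/
theorem question9_allWeights
    (hlt : ∀ (w : Sym2 V → unitInterval) (o : V), (∀ e : Sym2 V, e ∈ wireSet ({o}ᶜ : Set V) → w e < 1) →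
      ∀ (A : Finset V), o ∉ A → ∀ (b c : V), c ∈ A →
      (∀ a ∈ A, (prodBernoulli (restrW ({o}ᶜ : Set V) w)).real (openConn c b) ≤
        (prodBernoulli (restrW ({o}ᶜ : Set V) w)).real (openConn a b)) →
      (prodBernoulli w).real (openConn c b ∩ ⋃ a ∈ A, openConn o a) ≤
        (prodBernoulli w).real (openConn o b ∩ ⋃ a ∈ A, openConn o a))
    (w : Sym2 V → unitInterval) (o : V) (A : Finset V) (hoA : o ∉ A) (b c : V) (hcA : c ∈ A)
    (hmin : ∀ a ∈ A, (prodBernoulli (restrW ({o}ᶜ : Set V) w)).real (openConn c b) ≤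
      (prodBernoulli (restrW ({o}ᶜ : Set V) w)).real (openConn a b)) :
    (prodBernoulli w).real (openConn c b ∩ ⋃ a ∈ A, openConn o a) ≤
      (prodBernoulli w).real (openConn o b ∩ ⋃ a ∈ A, openConn o a) := by
  -- strong induction on the number of weight-one pairs off `o`
  suffices H : ∀ (n : ℕ) (w : Sym2 V → unitInterval) (A : Finset V) (b c : V),
      (Finset.univ.filter fun e => e ∈ wireSet ({o}ᶜ : Set V) ∧ w e = 1).card = n → o ∉ A → c ∈ A →
      (∀ a ∈ A, (prodBernoulli (restrW ({o}ᶜ : Set V) w)).real (openConn c b) ≤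
        (prodBernoulli (restrW ({o}ᶜ : Set V) w)).real (openConn a b)) →
      (prodBernoulli w).real (openConn c b ∩ ⋃ a ∈ A, openConn o a) ≤
        (prodBernoulli w).real (openConn o b ∩ ⋃ a ∈ A, openConn o a) from H _ w A b c rfl hoA hcA hmin
  intro n
  induction n using Nat.strong_induction_on with
  | _ n ih =>
    intro w A b c hn hoA hcA hmin
    set P := Finset.univ.filter fun e => e ∈ wireSet ({o}ᶜ : Set V) ∧ w e = 1 with hP
    rcases P.eq_empty_or_nonempty with hPe | hPne
    · -- no weight-one pair off `o`: the hypothesis applies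
      refine hlt w o (fun e he => ?_) A hoA b c hcA hmin
      have hne : w e ≠ 1 := fun h1 => by
        have : e ∈ P := by rw [hP, mem_ones_iff]; exact ⟨he, h1⟩
        rw [hPe] at this; exact absurd this (Finset.notMem_empty e)
      exact unitInterval.coe_lt_one.1 (lt_of_le_of_ne (w e).2.2 (fun h => hne (Subtype.ext h)))
    · -- contract a weight-one pair `e₀ = s(u,u')` off `o`
      obtain ⟨e₀, he₀⟩ := hPne
      obtain ⟨⟨u, u'⟩, hrep⟩ := Quot.exists_rep e₀
      have he₀' : s(u, u') ∈ P := by rw [show s(u, u') = e₀ from hrep]; exact he₀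
      rw [hP, mem_ones_iff, mk_mem_wireSet_iff] at he₀'
      obtain ⟨⟨huo, hu'o, huu'⟩, hw1⟩ := he₀'
      simp only [mem_compl_iff, mem_singleton_iff] at huo hu'o
      set w' := cweight u u' w with hw'
      have hlt_card := card_ones_cweight_lt (o := o) huu' huo hu'o w hw1
      rw [← hP, hn] at hlt_card
      -- the relay graphs
      have hH : cweight u u' (restrW ({o}ᶜ : Set V) w) = restrW ({o}ᶜ : Set V) w' := cweight_restrW huo hu'o w
      have hH1 : restrW ({o}ᶜ : Set V) w s(u, u') = 1 := by
        rw [restrW_apply_of_mem w (mk_mem_wireSet_iff.2 ⟨by simpa using huo, by simpa using hu'o, huu'⟩)]; exact hw1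
      -- induction hypothesis for the contraction
      have hoA' : o ∉ A.image (proj u u') := by
        rw [Finset.mem_image]
        rintro ⟨a, ha, hpa⟩
        by_cases hau : a = u'
        · subst hau; rw [proj_self] at hpa; exact huo hpa
        · rw [proj_of_ne hau] at hpa; exact hoA (hpa ▸ ha)
      have hcA' : proj u u' c ∈ A.image (proj u u') := Finset.mem_image_of_mem _ hcA
      have hmin' : ∀ a' ∈ A.image (proj u u'),
          (prodBernoulli (restrW ({o}ᶜ : Set V) w')).real (openConn (proj u u' c) (proj u u' b)) ≤
            (prodBernoulli (restrW ({o}ᶜ : Set V) w')).real (openConn a' (proj u u' b)) := by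
        intro a' ha'
        obtain ⟨a, ha, rfl⟩ := Finset.mem_image.1 ha'
        rw [← hH, ← real_openConn_eq huu' _ hH1, ← real_openConn_eq huu' _ hH1]
        exact hmin a ha
      have key := ih _ hlt_card w' (A.image (proj u u')) (proj u u' b) (proj u u' c) rfl hoA' hcA' hmin'
      -- transport back to `w`
      rw [real_conn_inter_eq huu' w hw1 (Ne.symm hu'o) c b A, real_conn_inter_eq huu' w hw1 (Ne.symm hu'o) o b A,
        proj_of_ne (Ne.symm hu'o)]
      exact key

end KnQ9Contract

end Summit.CriticalPhenomena.PercolationContinuityZ3.Theorems
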